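import Mathlib
import Summits.Ventures.PercRepro2.SwOutJunctionAsym
import Summits.Ventures.PercRepro2.SwOutNeverCoreGTyped

/-!
# The junction theorem on the general doubly typed side (blind cell PercRepro2, night-4 g30,
2026-08-28; proofs/NIGHT4-G30.md §9)

g11's junction theorem on g7's `gTypedQ ends l h 𝓤 𝓓 𝓓″ X 𝓤′`: the five conditions transport to
the graph split at `u` on the split-fine configurations — the clusters of `l` read on `inl` are
the clusters of `l` (g11), those of `h` read on `inl` are the clusters of `h` WITHOUT `u`
(`setOf_inl_mem_cluster_h_split`), so `𝓓″`, `𝓤′`, `X` must be blind to `u`; the pull-backs along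
`Sum.inl` are again admissible.  The rest is g11's proof with `card_orbit_le_g`:
**`rigidOK_g_of_junction`**, **`gTypedSwAll_of_junction`**.
-/

namespace Summit.Ventures.PercRepro2

namespace LocRows

open Hull

variable {V : Type*} {E : Type*} [Fintype E] [DecidableEq E]

open scoped Classical

variable {ends : E → Sym2 V} {U : Set V} {ξ : Config E} {l h u : V}
  {𝓤 𝓓 𝓓'' : Set (Set V)} {X : Set V} {𝓤' : Set (Set V)}

section Pull

omit [Fintype E] [DecidableEq E] in
/-- The pull-back of a down-set is a down-set. -/
lemma isLowerSet_pullInl {𝓓 : Set (Set V)} (h𝓓 : IsLowerSet 𝓓) : IsLowerSet (pullInl E 𝓓) :=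
  fun _ _ hST hS => h𝓓 (fun _ hx => hST hx) hS

omit [Fintype E] [DecidableEq E] in
/-- On a split-fine configuration the red cluster of `h` in the split graph, read on `inl`, is the
red cluster of `h` without `u` (no loop at `u`, `h ≠ u`). -/
lemma setOf_inl_mem_cluster_h_split (hloop : ∀ e, ends e ≠ s(u, u)) (hhu : h ≠ u) {η : Config E}
    (hf : SplitFine ends u h η) :
    {x | Sum.inl x ∈ cluster (splitEnds ends u) η (Sum.inl h)} = cluster ends η h \ {u} := by
  ext x
  simp only [Set.mem_setOf_eq, Set.mem_sdiff, Set.mem_singleton_iff]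
  rw [cluster_eq_insert_ends_redEdges (ends := splitEnds ends u),
    cluster_eq_insert_ends_redEdges (ends := ends), ← redEdges_eq_of_splitFine hloop hhu hf]
  simp only [Set.mem_insert_iff, Set.mem_setOf_eq, Sum.inl.injEq]
  constructor
  · rintro (rfl | ⟨e, he, hxe⟩)
    · exact ⟨Or.inl rfl, hhu⟩
    · rw [inl_mem_splitEnds_iff hloop] at hxe
      exact ⟨Or.inr ⟨e, he, hxe.1⟩, hxe.2⟩
  · rintro ⟨rfl | ⟨e, he, hxe⟩, hxu⟩
    · exact Or.inl rfl
    · exact Or.inr ⟨e, he, (inl_mem_splitEnds_iff hloop).2 ⟨hxe, hxu⟩⟩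

/-- **The general doubly typed side passes to the split** on split-fine configurations, the
conditions on `h`'s clusters blind to `u`. -/
theorem mem_gTypedQ_split_of_mem (hloop : ∀ e, ends e ≠ s(u, u)) (hlu : l ≠ u) (hhu : h ≠ u)
    (h𝓓'' : IsLowerSet 𝓓'') (hU' : ∀ S ∈ 𝓤', S \ {u} ∈ 𝓤') {η : Config E}
    (hf : SplitFine ends u h η) (hQ : η ∈ gTypedQ ends l h 𝓤 𝓓 𝓓'' X 𝓤') :
    η ∈ gTypedQ (splitEnds ends u) (Sum.inl l) (Sum.inl h) (pullInl E 𝓤) (pullInl E 𝓓)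
      (pullInl E 𝓓'') (Sum.inl '' X) (pullInl E 𝓤') := by
  rw [mem_gTypedQ] at hQ ⊢
  obtain ⟨hhl, hA, hB, hRh, hX, hBh⟩ := hQ
  have hhA' : Sum.inl h ∉ cluster (splitEnds ends u) η (Sum.inl l) :=
    fun h' => hhl (Or.inl (conn_of_conn_split_inl h'))
  have hhB' : Sum.inl h ∉ cluster (splitEnds ends u) (blue η) (Sum.inl l) :=
    fun h' => hhl (Or.inr (conn_of_conn_split_inl h'))
  have eRh := setOf_inl_mem_cluster_h_split hloop hhu hf
  have eBh := setOf_inl_mem_cluster_h_split hloop hhu (splitFine_blue_iff.2 hf)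
  refine ⟨?_, ?_, ?_, ?_, ?_, ?_⟩
  · rintro (h1 | h1)
    · exact hhA' h1
    · exact hhB' h1
  · show {x | Sum.inl x ∈ cluster (splitEnds ends u) η (Sum.inl l)} ∈ 𝓤
    rw [setOf_inl_mem_cluster_split hloop hlu hf hhA']
    exact hA
  · show {x | Sum.inl x ∈ cluster (splitEnds ends u) (blue η) (Sum.inl l)} ∈ 𝓓
    rw [setOf_inl_mem_cluster_split hloop hlu (splitFine_blue_iff.2 hf) hhB']
    exact hB
  · show {x | Sum.inl x ∈ cluster (splitEnds ends u) η (Sum.inl h)} ∈ 𝓓''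
    rw [eRh]
    exact h𝓓'' Set.sdiff_subset hRh
  · rintro x' ⟨x, hxX, rfl⟩ (h1 | h1)
    · have : x ∈ cluster ends η h \ {u} := by rw [← eRh]; exact h1
      exact hX x hxX (Or.inl this.1)
    · have : x ∈ cluster ends (blue η) h \ {u} := by rw [← eBh]; exact h1
      exact hX x hxX (Or.inr this.1)
  · show {x | Sum.inl x ∈ cluster (splitEnds ends u) (blue η) (Sum.inl h)} ∈ 𝓤'
    rw [eBh]
    exact hU' _ hBh

/-- **The general doubly typed side comes back from the split** on split-fine configurations. -/
theorem mem_gTypedQ_of_mem_split (hloop : ∀ e, ends e ≠ s(u, u)) (hlu : l ≠ u) (hhu : h ≠ u)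
    (h𝓓'' : IsLowerSet 𝓓'') (h𝓤' : IsUpperSet 𝓤') (hD'' : ∀ S ∈ 𝓓'', insert u S ∈ 𝓓'')
    (huX : u ∉ X) {η : Config E}
    (hf : SplitFine ends u h η)
    (hQ : η ∈ gTypedQ (splitEnds ends u) (Sum.inl l) (Sum.inl h) (pullInl E 𝓤) (pullInl E 𝓓)
      (pullInl E 𝓓'') (Sum.inl '' X) (pullInl E 𝓤')) :
    η ∈ gTypedQ ends l h 𝓤 𝓓 𝓓'' X 𝓤' := by
  rw [mem_gTypedQ] at hQ ⊢
  obtain ⟨hhl, hA, hB, hRh, hX, hBh⟩ := hQ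
  have hhA' : Sum.inl h ∉ cluster (splitEnds ends u) η (Sum.inl l) := fun h' => hhl (Or.inl h')
  have hhB' : Sum.inl h ∉ cluster (splitEnds ends u) (blue η) (Sum.inl l) :=
    fun h' => hhl (Or.inr h')
  have eA := setOf_inl_mem_cluster_split hloop hlu hf hhA'
  have eB := setOf_inl_mem_cluster_split hloop hlu (splitFine_blue_iff.2 hf) hhB'
  have eRh := setOf_inl_mem_cluster_h_split hloop hhu hf
  have eBh := setOf_inl_mem_cluster_h_split hloop hhu (splitFine_blue_iff.2 hf)
  refine ⟨?_, ?_, ?_, ?_, ?_, ?_⟩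
  · rintro (h1 | h1)
    · rw [← eA] at h1
      exact hhA' h1
    · rw [← eB] at h1
      exact hhB' h1
  · rw [← eA]; exact hA
  · rw [← eB]; exact hB
  · have h1 : cluster ends η h \ {u} ∈ 𝓓'' := by rw [← eRh]; exact hRh
    have h2 := hD'' _ h1
    have hsub : cluster ends η h ⊆ insert u (cluster ends η h \ {u}) := by
      intro x hx
      by_cases hxu : x = u
      · exact Or.inl hxu
      · exact Or.inr ⟨hx, hxu⟩
    exact h𝓓'' hsub h2
  · intro x hxX
    have hxu : x ≠ u := fun h' => huX (h' ▸ hxX)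
    rintro (h1 | h1)
    · have : Sum.inl x ∈ cluster (splitEnds ends u) η (Sum.inl h) := by
        show x ∈ {x | Sum.inl x ∈ cluster (splitEnds ends u) η (Sum.inl h)}
        rw [eRh]; exact ⟨h1, hxu⟩
      exact hX (Sum.inl x) ⟨x, hxX, rfl⟩ (Or.inl this)
    · have : Sum.inl x ∈ cluster (splitEnds ends u) (blue η) (Sum.inl h) := by
        show x ∈ {x | Sum.inl x ∈ cluster (splitEnds ends u) (blue η) (Sum.inl h)}
        rw [eBh]; exact ⟨h1, hxu⟩
      exact hX (Sum.inl x) ⟨x, hxX, rfl⟩ (Or.inr this)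
  · have h1 : cluster ends (blue η) h \ {u} ∈ 𝓤' := by rw [← eBh]; exact hBh
    exact h𝓤' Set.sdiff_subset h1

end Pull

section Core

variable {F : V → Prop}

/-- When every vertex of `U ∖ {h, u}` is exempt (forced into `C_R(l)`, forced out of `C_R(h)`, or
in `X`), has an outside edge, or no edge, every core of a `gTypedQ`-configuration is `h` or `u`. -/
theorem core_eq_h_or_u_g (hF : ∀ x, F x → (∀ S ∈ 𝓤, x ∈ S) ∨ (∀ S ∈ 𝓓'', x ∉ S) ∨ x ∈ X)
    (hout : ∀ x ∈ U, x ≠ h → x ≠ u →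
      F x ∨ (∃ e y, ends e = s(x, y) ∧ y ∉ U) ∨ (∀ e, x ∉ ends e))
    {ζ : Config E} (hζ : ζ ∈ gOutSide ends l h 𝓤 𝓓 𝓓'' X 𝓤' U ξ) {x : V}
    (hxT : x ∈ cluster ends ζ h) (hxTp : x ∈ cluster ends (blue ζ) h) : x = h ∨ x = u := by
  by_cases hxh : x = h
  · exact Or.inl hxh
  by_cases hxu : x = u
  · exact Or.inr hxu
  exfalso
  have hQ := (mem_gOutSide.1 hζ).1
  have hcl := (mem_gOutSide.1 hζ).2
  rw [mem_gTypedQ] at hQ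
  obtain ⟨hhl, hA, -, hRh, hX, -⟩ := hQ
  have hhA : h ∉ cluster ends ζ l := fun h' => hhl (Or.inl h')
  have hxU : x ∈ U := (mem_outClass.1 hcl).2 (Or.inl hxT)
  rcases hout x hxU hxh hxu with hf | ⟨e, y, hxy, hyU⟩ | hiso
  · rcases hF x hf with hf' | hf'' | hxX
    · exact hhA (conn_trans (hf' _ hA) (conn_symm hxT))
    · exact hf'' _ hRh hxT
    · exact hX x hxX (Or.inl hxT)
  · cases he : ζ e with
    | true => exact hyU ((mem_outClass.1 hcl).2 (Or.inl (mem_cluster_of_edge hxT he hxy)))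
    | false =>
      have he' : blue ζ e = true := by rw [blue_eq_true_iff]; exact he
      exact hyU ((mem_outClass.1 hcl).2 (Or.inr (mem_cluster_of_edge hxTp he' hxy)))
  · obtain ⟨e, hxe⟩ := exists_edge_of_mem_cluster hxT hxh
    exact hiso e hxe

/-- A split-fine `gTypedQ`-configuration is core-free in the split graph. -/
theorem coreFree_split_of_splitFine_g
    (hF : ∀ x, F x → (∀ S ∈ 𝓤, x ∈ S) ∨ (∀ S ∈ 𝓓'', x ∉ S) ∨ x ∈ X)
    (hloop : ∀ e, ends e ≠ s(u, u)) (hhu : h ≠ u)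
    (hout : ∀ x ∈ U, x ≠ h → x ≠ u →
      F x ∨ (∃ e y, ends e = s(x, y) ∧ y ∉ U) ∨ (∀ e, x ∉ ends e))
    {ζ : Config E} (hζ : ζ ∈ gOutSide ends l h 𝓤 𝓓 𝓓'' X 𝓤' U ξ) (hf : SplitFine ends u h ζ) :
    CoreFree (splitEnds ends u) ζ (Sum.inl h) := by
  rintro (x | e) hxT hxTp
  · have h1 : x ∈ cluster ends ζ h := conn_of_conn_split_inl hxT
    have h2 : x ∈ cluster ends (blue ζ) h := conn_of_conn_split_inl hxTp
    rcases core_eq_h_or_u_g hF hout hζ h1 h2 with rfl | rfl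
    · rfl
    · exact absurd hxT (inl_u_notMem_cluster_split hloop hhu)
  · exfalso
    obtain ⟨_, h1, _⟩ := conn_of_conn_split_inr hxT
    obtain ⟨_, h2, _⟩ := conn_of_conn_split_inr hxTp
    rw [blue_eq_true_iff] at h2
    rw [h1] at h2
    exact absurd h2 (by simp)

/-- A `gTypedQ`-configuration that is not split-fine is core-free. -/
theorem coreFree_of_not_splitFine_g
    (hF : ∀ x, F x → (∀ S ∈ 𝓤, x ∈ S) ∨ (∀ S ∈ 𝓓'', x ∉ S) ∨ x ∈ X)
    (hloop : ∀ e, ends e ≠ s(u, u)) (hhu : h ≠ u)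
    (hadj : ∀ e (he : u ∈ ends e), Sym2.Mem.other he ≠ h →
      ∃ e', ends e' = s(Sym2.Mem.other he, h))
    (hout : ∀ x ∈ U, x ≠ h → x ≠ u →
      F x ∨ (∃ e y, ends e = s(x, y) ∧ y ∉ U) ∨ (∀ e, x ∉ ends e))
    {ζ : Config E} (hζ : ζ ∈ gOutSide ends l h 𝓤 𝓓 𝓓'' X 𝓤' U ξ) (hnf : ¬ SplitFine ends u h ζ) :
    CoreFree ends ζ h := by
  intro x hxT hxTp
  rcases core_eq_h_or_u_g hF hout hζ hxT hxTp with rfl | rfl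
  · rfl
  · exfalso
    exact hnf (splitFine_of_matched hloop hhu hadj
      (fun y hy hy' => core_eq_h_or_u_g hF hout hζ hy hy') (matched_of_core hxT hxTp))

end Core

section Main

variable {F : V → Prop} (h𝓤 : IsUpperSet 𝓤) (h𝓓 : IsLowerSet 𝓓) (h𝓓'' : IsLowerSet 𝓓'')
  (h𝓤' : IsUpperSet 𝓤') (hD'' : ∀ S ∈ 𝓓'', insert u S ∈ 𝓓'') (hU' : ∀ S ∈ 𝓤', S \ {u} ∈ 𝓤')
  (huX : u ∉ X) (hF : ∀ x, F x → (∀ S ∈ 𝓤, x ∈ S) ∨ (∀ S ∈ 𝓓'', x ∉ S) ∨ x ∈ X)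
  (hl : l ∉ U) (hloop_h : ∀ e, ends e ≠ s(h, h)) (hloop_u : ∀ e, ends e ≠ s(u, u))
  (hu : u ∈ U) (hhu : h ≠ u)
  (hadj : ∀ e (he : u ∈ ends e), Sym2.Mem.other he ≠ h →
    ∃ e', ends e' = s(Sym2.Mem.other he, h))
  (hout : ∀ x ∈ U, x ≠ h → x ≠ u →
    F x ∨ (∃ e y, ends e = s(x, y) ∧ y ∉ U) ∨ (∀ e, x ∉ ends e))

include h𝓤 h𝓓 h𝓓'' h𝓤' hD'' hU' huX hF hl hloop_h hloop_u hu hhu hout in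
/-- The split-fine part, general doubly typed side. -/
theorem card_splitFine_le_g {𝓔 : Set (Set E)} (h𝓔 : IsUpperSet 𝓔) :
    ((gOutSide ends l h 𝓤 𝓓 𝓓'' X 𝓤' U ξ).filter fun ζ =>
        redEdges ends ζ h ∈ 𝓔 ∧ SplitFine ends u h ζ).card ≤
      ((gOutSide ends l h 𝓤 𝓓 𝓓'' X 𝓤' U ξ).filter fun ζ =>
        blueEdges ends ζ h ∈ 𝓔 ∧ SplitFine ends u h ζ).card := by
  have hlu : l ≠ u := fun h' => hl (h' ▸ hu)
  have hl' := inl_notMem_splitRegion (V := V) (E := E) hl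
  have hloop' := splitEnds_ne_loop_h (ends := ends) (u := u) hloop_h
  set G := gOutSide ends l h 𝓤 𝓓 𝓓'' X 𝓤' U ξ with hG
  let can : Config E → Config E := fun ζ => allRed (splitEnds ends u) ζ (Sum.inl h)
  let Fs : Finset (Config E) := G.filter fun ζ => SplitFine ends u h ζ
  let S₀ : Finset (Config E) := Fs.image can
  have hmap : ∀ (P : Config E → Prop) (ζ : Config E),
      ζ ∈ G.filter (fun ζ => P ζ ∧ SplitFine ends u h ζ) → can ζ ∈ S₀ := by
    intro P ζ hζ
    have hζ' := Finset.mem_filter.1 hζ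
    exact Finset.mem_image_of_mem can (Finset.mem_filter.2 ⟨hζ'.1, hζ'.2.2⟩)
  rw [Finset.card_eq_sum_card_fiberwise (hmap _), Finset.card_eq_sum_card_fiberwise (hmap _)]
  refine Finset.sum_le_sum fun ζ₀ hζ₀ => ?_
  obtain ⟨ζ₁, hζ₁, rfl⟩ := Finset.mem_image.1 hζ₀
  have hζ₁' := Finset.mem_filter.1 hζ₁
  have hSF₁ : SplitFine ends u h ζ₁ := hζ₁'.2
  have hc₁ : CoreFree (splitEnds ends u) ζ₁ (Sum.inl h) :=
    coreFree_split_of_splitFine_g hF hloop_u hhu hout hζ₁'.1 hSF₁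
  have hcl₁ : ζ₁ ∈ outClass (splitEnds ends u) (splitRegion U) (Sum.inl h) ξ :=
    mem_outClass_split_of_mem hu (mem_gOutSide.1 hζ₁'.1).2
  have hc₀ : CoreFree (splitEnds ends u) (allRed (splitEnds ends u) ζ₁ (Sum.inl h)) (Sum.inl h) :=
    coreFree_allRed hc₁
  have hcl₀ : allRed (splitEnds ends u) ζ₁ (Sum.inl h) ∈
      outClass (splitEnds ends u) (splitRegion U) (Sum.inl h) ξ := allRed_mem_outClass hcl₁ hc₁
  have hfib : ∀ (P P' : Config E → Prop), (∀ ζ, SplitFine ends u h ζ → (P ζ ↔ P' ζ)) →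
      (G.filter (fun ζ => P ζ ∧ SplitFine ends u h ζ)).filter (fun ζ => can ζ = can ζ₁) =
        (orbit (splitEnds ends u) (allRed (splitEnds ends u) ζ₁ (Sum.inl h)) (Sum.inl h)).filter
          fun ζ' => ζ' ∈ gTypedQ (splitEnds ends u) (Sum.inl l) (Sum.inl h) (pullInl E 𝓤)
            (pullInl E 𝓓) (pullInl E 𝓓'') (Sum.inl '' X) (pullInl E 𝓤') ∧ P' ζ' := by
    intro P P' hPP'
    ext ζ'
    simp only [Finset.mem_filter, orbit, Finset.mem_image, Finset.mem_univ, true_and, can]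
    constructor
    · rintro ⟨⟨hζ', hP, hSF⟩, hcan⟩
      have hc' : CoreFree (splitEnds ends u) ζ' (Sum.inl h) :=
        coreFree_split_of_splitFine_g hF hloop_u hhu hout hζ' hSF
      obtain ⟨ω, hω⟩ := exists_orbitReal_eq hc' hcan
      exact ⟨⟨ω, hω⟩, mem_gTypedQ_split_of_mem hloop_u hlu hhu h𝓓'' hU' hSF
        (mem_gOutSide.1 hζ').1, (hPP' ζ' hSF).1 hP⟩
    · rintro ⟨⟨ω, rfl⟩, hQ', hP'⟩
      have hSF' : SplitFine ends u h
          (orbitReal (splitEnds ends u) (allRed (splitEnds ends u) ζ₁ (Sum.inl h)) (Sum.inl h) ω) := by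
        intro e he
        rw [hull_orbitReal hc₀, hull_allRed hc₁]
        exact hSF₁ e he
      have hcl' := orbitReal_mem_outClass hc₀ hcl₀ ω
      refine ⟨⟨mem_gOutSide.2 ⟨mem_gTypedQ_of_mem_split hloop_u hlu hhu h𝓓'' h𝓤' hD'' huX hSF' hQ',
        mem_outClass_of_mem_split hu hloop_u hhu hSF' hcl'⟩, (hPP' _ hSF').2 hP', hSF'⟩, ?_⟩
      rw [allRed_orbitReal hc₀ ω, allRed_idem hc₁]
  rw [hfib _ (fun ζ' => redEdges (splitEnds ends u) ζ' (Sum.inl h) ∈ 𝓔)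
      (fun ζ hSF => by rw [redEdges_eq_of_splitFine hloop_u hhu hSF]),
    hfib _ (fun ζ' => blueEdges (splitEnds ends u) ζ' (Sum.inl h) ∈ 𝓔)
      (fun ζ hSF => by rw [blueEdges_eq_of_splitFine hloop_u hhu hSF])]
  exact card_orbit_le_g hc₀ hloop' (isUpperSet_pullInl h𝓤) (isLowerSet_pullInl h𝓓)
    (isLowerSet_pullInl h𝓓'') (isUpperSet_pullInl h𝓤') hcl₀ hl' h𝓔

include h𝓤 h𝓓 h𝓓'' h𝓤' hF hloop_h hloop_u hhu hadj hout hl in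
/-- **The non-split-fine part**, general doubly typed side. -/
theorem card_not_splitFine_le_g {𝓔 : Set (Set E)} (h𝓔 : IsUpperSet 𝓔) :
    ((gOutSide ends l h 𝓤 𝓓 𝓓'' X 𝓤' U ξ).filter fun ζ =>
        redEdges ends ζ h ∈ 𝓔 ∧ ¬ SplitFine ends u h ζ).card ≤
      ((gOutSide ends l h 𝓤 𝓓 𝓓'' X 𝓤' U ξ).filter fun ζ =>
        blueEdges ends ζ h ∈ 𝓔 ∧ ¬ SplitFine ends u h ζ).card := by
  set G := gOutSide ends l h 𝓤 𝓓 𝓓'' X 𝓤' U ξ with hG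
  let can : Config E → Config E := fun ζ => allRed ends ζ h
  let Fs : Finset (Config E) := G.filter fun ζ => ¬ SplitFine ends u h ζ
  let S₀ : Finset (Config E) := Fs.image can
  have hmap : ∀ (P : Config E → Prop) (ζ : Config E),
      ζ ∈ G.filter (fun ζ => P ζ ∧ ¬ SplitFine ends u h ζ) → can ζ ∈ S₀ := by
    intro P ζ hζ
    have hζ' := Finset.mem_filter.1 hζ
    exact Finset.mem_image_of_mem can (Finset.mem_filter.2 ⟨hζ'.1, hζ'.2.2⟩)
  rw [Finset.card_eq_sum_card_fiberwise (hmap _), Finset.card_eq_sum_card_fiberwise (hmap _)]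
  refine Finset.sum_le_sum fun ζ₀ hζ₀ => ?_
  obtain ⟨ζ₁, hζ₁, rfl⟩ := Finset.mem_image.1 hζ₀
  have hζ₁' := Finset.mem_filter.1 hζ₁
  have hnf₁ : ¬ SplitFine ends u h ζ₁ := hζ₁'.2
  have hc₁ : CoreFree ends ζ₁ h :=
    coreFree_of_not_splitFine_g hF hloop_u hhu hadj hout hζ₁'.1 hnf₁
  have hcl₁ : ζ₁ ∈ outClass ends U h ξ := (mem_gOutSide.1 hζ₁'.1).2
  have hc₀ : CoreFree ends (allRed ends ζ₁ h) h := coreFree_allRed hc₁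
  have hcl₀ : allRed ends ζ₁ h ∈ outClass ends U h ξ := allRed_mem_outClass hcl₁ hc₁
  have hnf₀ : ¬ SplitFine ends u h (allRed ends ζ₁ h) :=
    not_splitFine_flip hloop_u hhu hadj hc₁ (armClosed_blueSide hc₁) hnf₁
  have hfib : ∀ (P : Config E → Prop),
      (G.filter (fun ζ => P ζ ∧ ¬ SplitFine ends u h ζ)).filter (fun ζ => can ζ = can ζ₁) =
        (orbit ends (allRed ends ζ₁ h) h).filter
          fun ζ' => ζ' ∈ gTypedQ ends l h 𝓤 𝓓 𝓓'' X 𝓤' ∧ P ζ' := by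
    intro P
    ext ζ'
    simp only [Finset.mem_filter, orbit, Finset.mem_image, Finset.mem_univ, true_and, can]
    constructor
    · rintro ⟨⟨hζ', hP, hnf⟩, hcan⟩
      have hc' : CoreFree ends ζ' h :=
        coreFree_of_not_splitFine_g hF hloop_u hhu hadj hout hζ' hnf
      obtain ⟨ω, hω⟩ := exists_orbitReal_eq hc' hcan
      exact ⟨⟨ω, hω⟩, (mem_gOutSide.1 hζ').1, hP⟩
    · rintro ⟨⟨ω, rfl⟩, hQ, hP⟩
      have hnf' : ¬ SplitFine ends u h (orbitReal ends (allRed ends ζ₁ h) h ω) := by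
        show ¬ SplitFine ends u h
          (flip ends (armsFalse ends (allRed ends ζ₁ h) h ω) (allRed ends (allRed ends ζ₁ h) h))
        refine not_splitFine_flip hloop_u hhu hadj (coreFree_allRed hc₀)
          (armClosed_armsFalse_allRed hc₀ ω) ?_
        exact not_splitFine_flip hloop_u hhu hadj hc₀ (armClosed_blueSide hc₀) hnf₀
      refine ⟨⟨mem_gOutSide.2 ⟨hQ, orbitReal_mem_outClass hc₀ hcl₀ ω⟩, hP, hnf'⟩, ?_⟩
      rw [allRed_orbitReal hc₀ ω, allRed_idem hc₁]
  rw [hfib, hfib]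
  exact card_orbit_le_g hc₀ hloop_h h𝓤 h𝓓 h𝓓'' h𝓤' hcl₀ hl h𝓔

include h𝓤 h𝓓 h𝓓'' h𝓤' hD'' hU' huX hF hl hloop_h hloop_u hu hhu hadj hout in
/-- **THE JUNCTION THEOREM ON THE GENERAL DOUBLY TYPED SIDE** (one junction `u`, the conditions on
`h`'s clusters blind to `u`, every other vertex of `U ∖ {h}` exempt, with an outside edge, or isolated). -/
theorem rigidOK_g_of_junction {𝓔 : Set (Set E)} (h𝓔 : IsUpperSet 𝓔) :
    ((gOutSide ends l h 𝓤 𝓓 𝓓'' X 𝓤' U ξ).filter fun ζ => redEdges ends ζ h ∈ 𝓔).card ≤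
      ((gOutSide ends l h 𝓤 𝓓 𝓓'' X 𝓤' U ξ).filter fun ζ => blueEdges ends ζ h ∈ 𝓔).card := by
  have hsplit : ∀ P : Config E → Prop,
      ((gOutSide ends l h 𝓤 𝓓 𝓓'' X 𝓤' U ξ).filter P).card =
        ((gOutSide ends l h 𝓤 𝓓 𝓓'' X 𝓤' U ξ).filter fun ζ => P ζ ∧ SplitFine ends u h ζ).card +
        ((gOutSide ends l h 𝓤 𝓓 𝓓'' X 𝓤' U ξ).filter fun ζ =>
          P ζ ∧ ¬ SplitFine ends u h ζ).card := by
    intro P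
    rw [← Finset.filter_filter, ← Finset.filter_filter,
      Finset.card_filter_add_card_filter_not]
  rw [hsplit, hsplit]
  exact Nat.add_le_add
    (card_splitFine_le_g h𝓤 h𝓓 h𝓓'' h𝓤' hD'' hU' huX hF hl hloop_h hloop_u hu hhu hout h𝓔)
    (card_not_splitFine_le_g h𝓤 h𝓓 h𝓓'' h𝓤' hF hl hloop_h hloop_u hhu hadj hout h𝓔)

end Main

section Graph

variable {F : V → Prop}

/-- **The general doubly typed row on every graph with one junction** `u ≠ l, h` in the region
`{l}ᶜ` (the conditions on `h`'s clusters blind to `u`; every other vertex exempt, joined to `l`,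
or isolated). -/
theorem gTypedSwAll_of_junction (hlh : l ≠ h) (hlu : l ≠ u) (hhu : h ≠ u)
    (hloop_h : ∀ e, ends e ≠ s(h, h)) (hloop_u : ∀ e, ends e ≠ s(u, u))
    (h𝓤 : IsUpperSet 𝓤) (h𝓓 : IsLowerSet 𝓓) (h𝓓'' : IsLowerSet 𝓓'') (h𝓤' : IsUpperSet 𝓤')
    (hD'' : ∀ S ∈ 𝓓'', insert u S ∈ 𝓓'') (hU' : ∀ S ∈ 𝓤', S \ {u} ∈ 𝓤') (huX : u ∉ X)
    (hF : ∀ x, F x → (∀ S ∈ 𝓤, x ∈ S) ∨ (∀ S ∈ 𝓓'', x ∉ S) ∨ x ∈ X)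
    (hadj : ∀ e (he : u ∈ ends e), Sym2.Mem.other he ≠ h →
      ∃ e', ends e' = s(Sym2.Mem.other he, h))
    (hout : ∀ x, x ≠ l → x ≠ h → x ≠ u →
      F x ∨ (∃ e, ends e = s(x, l)) ∨ (∀ e, x ∉ ends e)) :
    GTypedSwAll ends l h 𝓤 𝓓 𝓓'' X 𝓤' := by
  refine exists_swAll_injection_of_card_le h _ (card_le_g_of_classes hlh fun ξ 𝓔 h𝓔 => ?_)
  refine rigidOK_g_of_junction (ξ := ξ) (u := u) h𝓤 h𝓓 h𝓓'' h𝓤' hD'' hU' huX hF (by simp)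
    hloop_h hloop_u (by simpa using hlu.symm) hhu hadj ?_ h𝓔
  intro x hx hxh hxu
  rcases hout x (by simpa using hx) hxh hxu with hf | ⟨e, he⟩ | hiso
  · exact Or.inl hf
  · exact Or.inr (Or.inl ⟨e, l, he, by simp⟩)
  · exact Or.inr (Or.inr hiso)

end Graph

end LocRows

end Summit.Ventures.PercRepro2
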